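import Mathlib
import HarnessLib

/-!
# The Shapiro polynomials and a uniformly but not absolutely convergent Chebyshev series

Source: T. J. Rivlin, *The Chebyshev Polynomials* (Wiley, 1974), Sect. 3.3 "Chebyshev Series",
pp. 115–118 of the printing (formulas (3.17)–(3.24), LEMMA 3.3.1, THEOREM 3.1). [cite: Rivlin1974]

A Chebyshev series `B₀/2 + Σ_{k ≥ 1} B_k T_k(x)` (3.17) with `Σ' |B_k| < ∞` (3.18) converges
absolutely and uniformly on `I = [-1, 1]`; Rivlin writes `A(I) ⊆ U(I)` and shows `A(I) ≠ U(I)` by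
an example built from the polynomials of H. S. Shapiro (3.19)–(3.20):

* `shapiroP k`, `shapiroQ k` — the pair `f, g` of (3.19) with the now customary indexing
  `P₀ = Q₀ = 1`, `P_{k+1} = P_k + z^{2^k} Q_k`, `Q_{k+1} = P_k - z^{2^k} Q_k`, so that Rivlin's
  `f_k = shapiroP k`, `g_k = shapiroQ k` for `k ≥ 1` (`f₁ = 1 + z`, `g₁ = 1 - z`); they have degree
  `2^k - 1` and all coefficients `±1` (`natDegree_shapiroP`, `coeff_shapiroP_eq_one_or_eq_neg_one`),
  the first `2^k` coefficients of `f_{k+1}` are those of `f_k` and the next `2^k` are obtained by the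
  recopying rule (`coeff_shapiroP_succ_of_lt`, `coeff_shapiroP_succ_two_pow_add_of_lt`,
  `coeff_shapiroP_succ_two_pow_add_of_le`); e.g. `f₂ = 1 + z + z² - z³` (`shapiroP_two`).
* `shapiroSeq j = ε_j` — the resulting `±1` sequence (3.20) and `shapiroSum n z = 𝒮_n(z) = Σ_{j ≤ n} ε_j z^j`,
  with `f_k = 𝒮_{2^k - 1}` (`shapiroSum_two_pow_sub_one`).
* On `|z| = 1`: `|f_k(z)|² + |g_k(z)|² = 2^{k+1}` (`norm_sq_aeval_shapiroP_add`), hence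
  `|f_k(z)| ≤ 2^{(k+1)/2}` (3.22) and LEMMA 3.3.1 (`norm_shapiroSum_le`):
  `|𝒮_n(e^{iθ})| ≤ 5 n^{1/2}` for `n ≥ 1`, through (3.23a)–(3.23b)
  (`norm_shapiroSum_le_of_lt_two_pow`).
* THEOREM 3.1: the Chebyshev series `Σ_{k ≥ 1} (ε_k / k) T_k(x)` (3.24) is uniformly convergent on `I`
  — the partial sums `chebyshevShapiroSum N x` satisfy the block estimate
  `|Σ_{k=n}^{N} ε_k T_k(x)/k| ≤ 20 n^{-1/2}` of the printed proof (summation by parts + (3.21),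
  `abs_sum_Icc_shapiroSeq_mul_T_div_le`), are uniformly Cauchy
  (`uniformCauchySeqOn_chebyshevShapiroSum`) and converge uniformly on `I` to a continuous sum
  (`exists_tendstoUniformlyOn_chebyshevShapiroSum`) — but not absolutely convergent: (3.18) fails,
  indeed already at `x = 1` the terms have absolute value `1/k` (`not_summable_abs_shapiroSeq_div`).

Everything here is proved (no named facts). Not formalised here: the remark after Lemma 3.3.1
(by Parseval every polynomial of degree `n` with unimodular coefficients has maximum modulus
`≥ (n+1)^{1/2}` on `|z| = 1`), and the rest of Sect. 3.3 from (3.25) on (Chebyshev expansions,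
THEOREM 3.2 ff.), which concern the coefficient integrals rather than the Shapiro example.
-/

namespace Literature.Analysis.Approximation.ShapiroPolynomials

open Polynomial Finset Filter

/-! ### The Shapiro polynomials (3.19) -/

/-- The Shapiro pair `(f, g)` of (3.19), indexed from `P₀ = Q₀ = 1`:
`P_{k+1} = P_k + z^{2^k} Q_k`, `Q_{k+1} = P_k - z^{2^k} Q_k`. [cite: Rivlin1974, Sect. 3.3 (3.19)] -/
noncomputable def shapiroPQ : ℕ → ℤ[X] × ℤ[X]
  | 0 => (1, 1)
  | k + 1 => ((shapiroPQ k).1 + X ^ 2 ^ k * (shapiroPQ k).2,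
      (shapiroPQ k).1 - X ^ 2 ^ k * (shapiroPQ k).2)

/-- Rivlin's `f_k` (for `k ≥ 1`): the `k`-th Shapiro polynomial `P_k`. [cite: Rivlin1974, Sect. 3.3 (3.19)] -/
noncomputable def shapiroP (k : ℕ) : ℤ[X] := (shapiroPQ k).1

/-- Rivlin's `g_k` (for `k ≥ 1`): the companion Shapiro polynomial `Q_k`. [cite: Rivlin1974, Sect. 3.3 (3.19)] -/
noncomputable def shapiroQ (k : ℕ) : ℤ[X] := (shapiroPQ k).2

/-- `P₀ = 1`. [cite: Rivlin1974, Sect. 3.3 (3.19)] -/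
theorem shapiroP_zero : shapiroP 0 = 1 := rfl

/-- `Q₀ = 1`. [cite: Rivlin1974, Sect. 3.3 (3.19)] -/
theorem shapiroQ_zero : shapiroQ 0 = 1 := rfl

/-- (3.19): `f_{k+1} = f_k + z^{2^k} g_k`. [cite: Rivlin1974, Sect. 3.3 (3.19)] -/
theorem shapiroP_succ (k : ℕ) : shapiroP (k + 1) = shapiroP k + X ^ 2 ^ k * shapiroQ k := rfl

/-- (3.19): `g_{k+1} = f_k - z^{2^k} g_k`. [cite: Rivlin1974, Sect. 3.3 (3.19)] -/
theorem shapiroQ_succ (k : ℕ) : shapiroQ (k + 1) = shapiroP k - X ^ 2 ^ k * shapiroQ k := rfl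

/-- `f₁(z) = 1 + z`. [cite: Rivlin1974, Sect. 3.3 (3.19)] -/
theorem shapiroP_one : shapiroP 1 = 1 + X := by
  rw [shapiroP_succ, shapiroP_zero, shapiroQ_zero]; simp

/-- `g₁(z) = 1 - z`. [cite: Rivlin1974, Sect. 3.3 (3.19)] -/
theorem shapiroQ_one : shapiroQ 1 = 1 - X := by
  rw [shapiroQ_succ, shapiroP_zero, shapiroQ_zero]; simp

/-- `f₂(z) = 1 + z + z² - z³`. [cite: Rivlin1974, Sect. 3.3 (after (3.19))] -/
theorem shapiroP_two : shapiroP 2 = 1 + X + X ^ 2 - X ^ 3 := by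
  rw [shapiroP_succ, shapiroP_one, shapiroQ_one]; ring

/-- `g₂(z) = 1 + z - z² + z³`. [cite: Rivlin1974, Sect. 3.3 (3.19)] -/
theorem shapiroQ_two : shapiroQ 2 = 1 + X - X ^ 2 + X ^ 3 := by
  rw [shapiroQ_succ, shapiroP_one, shapiroQ_one]; ring

/-- `f₃(z) = 1 + z + z² - z³ + z⁴ + z⁵ - z⁶ + z⁷`. [cite: Rivlin1974, Sect. 3.3 (after (3.19))] -/
theorem shapiroP_three :
    shapiroP 3 = 1 + X + X ^ 2 - X ^ 3 + X ^ 4 + X ^ 5 - X ^ 6 + X ^ 7 := by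
  rw [shapiroP_succ, shapiroP_two, shapiroQ_two]; ring

/-- Coefficients of `f_{k+1}` from those of `f_k, g_k`. [cite: Rivlin1974, Sect. 3.3 (3.19)] -/
theorem coeff_shapiroP_succ (k i : ℕ) :
    (shapiroP (k + 1)).coeff i =
      (shapiroP k).coeff i + if 2 ^ k ≤ i then (shapiroQ k).coeff (i - 2 ^ k) else 0 := by
  rw [shapiroP_succ, coeff_add, coeff_X_pow_mul']

/-- Coefficients of `g_{k+1}` from those of `f_k, g_k`. [cite: Rivlin1974, Sect. 3.3 (3.19)] -/
theorem coeff_shapiroQ_succ (k i : ℕ) :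
    (shapiroQ (k + 1)).coeff i =
      (shapiroP k).coeff i - if 2 ^ k ≤ i then (shapiroQ k).coeff (i - 2 ^ k) else 0 := by
  rw [shapiroQ_succ, coeff_sub, coeff_X_pow_mul']

/-- The coefficient pattern of the pair `(f_k, g_k)`: `±1` below `2^k`, `0` from `2^k` on. [folklore] -/
private theorem coeff_shapiro_aux (k : ℕ) : ∀ i : ℕ,
    (i < 2 ^ k → ((shapiroP k).coeff i = 1 ∨ (shapiroP k).coeff i = -1) ∧
      ((shapiroQ k).coeff i = 1 ∨ (shapiroQ k).coeff i = -1)) ∧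
    (2 ^ k ≤ i → (shapiroP k).coeff i = 0 ∧ (shapiroQ k).coeff i = 0) := by
  induction k with
  | zero =>
    intro i
    refine ⟨fun hi => ?_, fun hi => ?_⟩
    · have h0 : i = 0 := by simpa using hi
      subst h0
      simp [shapiroP_zero, shapiroQ_zero]
    · have h0 : i ≠ 0 := by
        simp only [pow_zero] at hi
        omega
      simp [shapiroP_zero, shapiroQ_zero, coeff_one, h0]
  | succ k ih =>
    intro i
    have h2 : 2 ^ (k + 1) = 2 * 2 ^ k := by ring
    rw [coeff_shapiroP_succ, coeff_shapiroQ_succ]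
    refine ⟨fun hi => ?_, fun hi => ?_⟩
    · by_cases h : 2 ^ k ≤ i
      · have hz := (ih i).2 h
        have hs := ((ih (i - 2 ^ k)).1 (by omega)).2
        simp only [h, if_true, hz.1, zero_add, zero_sub]
        rcases hs with hs | hs <;> simp [hs]
      · rw [not_le] at h
        have hs := ((ih i).1 h).1
        simpa [not_le.mpr h] using And.intro hs hs
    · have h : 2 ^ k ≤ i := by omega
      have hz := (ih i).2 h
      have hz' := (ih (i - 2 ^ k)).2 (by omega)
      simp [h, hz.1, hz'.2]

/-- The coefficients of `f_k` of index `< 2^k` are `±1`. [cite: Rivlin1974, Sect. 3.3 (after (3.19))] -/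
theorem coeff_shapiroP_eq_one_or_eq_neg_one {k i : ℕ} (hi : i < 2 ^ k) :
    (shapiroP k).coeff i = 1 ∨ (shapiroP k).coeff i = -1 :=
  ((coeff_shapiro_aux k i).1 hi).1

/-- The coefficients of `g_k` of index `< 2^k` are `±1`. [cite: Rivlin1974, Sect. 3.3 (after (3.19))] -/
theorem coeff_shapiroQ_eq_one_or_eq_neg_one {k i : ℕ} (hi : i < 2 ^ k) :
    (shapiroQ k).coeff i = 1 ∨ (shapiroQ k).coeff i = -1 :=
  ((coeff_shapiro_aux k i).1 hi).2

/-- `f_k` has no coefficients of index `≥ 2^k`. [cite: Rivlin1974, Sect. 3.3 (after (3.19))] -/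
theorem coeff_shapiroP_eq_zero {k i : ℕ} (hi : 2 ^ k ≤ i) : (shapiroP k).coeff i = 0 :=
  ((coeff_shapiro_aux k i).2 hi).1

/-- `g_k` has no coefficients of index `≥ 2^k`. [cite: Rivlin1974, Sect. 3.3 (after (3.19))] -/
theorem coeff_shapiroQ_eq_zero {k i : ℕ} (hi : 2 ^ k ≤ i) : (shapiroQ k).coeff i = 0 :=
  ((coeff_shapiro_aux k i).2 hi).2

/-- `f_k` is a polynomial of degree `2^k - 1`. [cite: Rivlin1974, Sect. 3.3 (after (3.19))] -/
theorem natDegree_shapiroP (k : ℕ) : (shapiroP k).natDegree = 2 ^ k - 1 := by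
  have hk : 0 < 2 ^ k := by positivity
  refine natDegree_eq_of_le_of_coeff_ne_zero ?_ ?_
  · exact (natDegree_le_iff_coeff_eq_zero).2 fun N hN => coeff_shapiroP_eq_zero (by omega)
  · rcases coeff_shapiroP_eq_one_or_eq_neg_one (k := k) (i := 2 ^ k - 1) (by omega) with h | h <;>
      simp [h]

/-- `g_k` is a polynomial of degree `2^k - 1`. [cite: Rivlin1974, Sect. 3.3 (after (3.19))] -/
theorem natDegree_shapiroQ (k : ℕ) : (shapiroQ k).natDegree = 2 ^ k - 1 := by
  have hk : 0 < 2 ^ k := by positivity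
  refine natDegree_eq_of_le_of_coeff_ne_zero ?_ ?_
  · exact (natDegree_le_iff_coeff_eq_zero).2 fun N hN => coeff_shapiroQ_eq_zero (by omega)
  · rcases coeff_shapiroQ_eq_one_or_eq_neg_one (k := k) (i := 2 ^ k - 1) (by omega) with h | h <;>
      simp [h]

/-- "Given `f_n`, the first `2^n` coefficients of `f_{n+1}` are precisely the coefficients of `f_n`."
[cite: Rivlin1974, Sect. 3.3 (after (3.19))] -/
theorem coeff_shapiroP_succ_of_lt {k i : ℕ} (hi : i < 2 ^ k) :
    (shapiroP (k + 1)).coeff i = (shapiroP k).coeff i := by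
  rw [coeff_shapiroP_succ, if_neg (not_le.mpr hi), add_zero]

/-- The first `2^k` coefficients of `g_{k+1}` are those of `f_k`. [cite: Rivlin1974, Sect. 3.3 (3.19)] -/
theorem coeff_shapiroQ_succ_of_lt {k i : ℕ} (hi : i < 2 ^ k) :
    (shapiroQ (k + 1)).coeff i = (shapiroP k).coeff i := by
  rw [coeff_shapiroQ_succ, if_neg (not_le.mpr hi), sub_zero]

/-- The upper `2^k` coefficients of `f_{k+1}` are those of `g_k`. [cite: Rivlin1974, Sect. 3.3 (3.19)] -/
theorem coeff_shapiroP_succ_two_pow_add (k i : ℕ) :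
    (shapiroP (k + 1)).coeff (2 ^ k + i) = (shapiroQ k).coeff i := by
  rw [coeff_shapiroP_succ, if_pos (Nat.le_add_right _ _), coeff_shapiroP_eq_zero (Nat.le_add_right _ _),
    zero_add, Nat.add_sub_cancel_left]

/-- The upper `2^k` coefficients of `g_{k+1}` are the negatives of those of `g_k`.
[cite: Rivlin1974, Sect. 3.3 (3.19)] -/
theorem coeff_shapiroQ_succ_two_pow_add (k i : ℕ) :
    (shapiroQ (k + 1)).coeff (2 ^ k + i) = -(shapiroQ k).coeff i := by
  rw [coeff_shapiroQ_succ, if_pos (Nat.le_add_right _ _), coeff_shapiroP_eq_zero (Nat.le_add_right _ _),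
    zero_sub, Nat.add_sub_cancel_left]

/-- The recopying rule, first half: coefficients `2^{k+1}, …, 2^{k+1} + 2^k - 1` of `f_{k+2}` recopy the
first `2^k` coefficients of `f_{k+1}`. [cite: Rivlin1974, Sect. 3.3 (after (3.19))] -/
theorem coeff_shapiroP_succ_two_pow_add_of_lt {k i : ℕ} (hi : i < 2 ^ k) :
    (shapiroP (k + 2)).coeff (2 ^ (k + 1) + i) = (shapiroP (k + 1)).coeff i := by
  rw [coeff_shapiroP_succ_two_pow_add, coeff_shapiroQ_succ_of_lt hi, coeff_shapiroP_succ_of_lt hi]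

/-- The recopying rule, second half: coefficients `2^{k+1} + 2^k, …, 2^{k+2} - 1` of `f_{k+2}` are the
negatives of coefficients `2^k, …, 2^{k+1} - 1` of `f_{k+1}` (stated for every index `i ≥ 2^k`;
both sides vanish beyond). [cite: Rivlin1974, Sect. 3.3 (after (3.19))] -/
theorem coeff_shapiroP_succ_two_pow_add_of_le {k i : ℕ} (hki : 2 ^ k ≤ i) :
    (shapiroP (k + 2)).coeff (2 ^ (k + 1) + i) = -(shapiroP (k + 1)).coeff i := by
  obtain ⟨j, rfl⟩ := Nat.exists_eq_add_of_le hki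
  rw [coeff_shapiroP_succ_two_pow_add, coeff_shapiroQ_succ_two_pow_add, coeff_shapiroP_succ_two_pow_add]

/-- Stability of the coefficients: for `k ≤ K` the coefficients of index `< 2^k` of `f_K` and `f_k`
agree. [cite: Rivlin1974, Sect. 3.3 (3.20)] -/
theorem coeff_shapiroP_of_le {k K i : ℕ} (hkK : k ≤ K) (hi : i < 2 ^ k) :
    (shapiroP K).coeff i = (shapiroP k).coeff i := by
  induction K, hkK using Nat.le_induction with
  | base => rfl
  | succ K hkK ih =>
    rw [coeff_shapiroP_succ_of_lt (lt_of_lt_of_le hi (Nat.pow_le_pow_right (by norm_num) hkK)), ih]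

/-! ### The Shapiro sequence (3.20) and its partial sums `𝒮_n` -/

/-- The Shapiro sequence `ε_j = ±1` of (3.20): the `j`-th coefficient of every `f_k` with `2^k > j`.
[cite: Rivlin1974, Sect. 3.3 (3.20)] -/
noncomputable def shapiroSeq (j : ℕ) : ℤ := (shapiroP (j + 1)).coeff j

/-- `f_k(z) = Σ_{j < 2^k} ε_j z^j`: the coefficients of `f_k` are the `ε_j`. [cite: Rivlin1974, Sect. 3.3 (3.20)] -/
theorem coeff_shapiroP_eq_shapiroSeq {k j : ℕ} (hj : j < 2 ^ k) : (shapiroP k).coeff j = shapiroSeq j := by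
  unfold shapiroSeq
  have hj' : j < 2 ^ (j + 1) :=
    lt_trans (Nat.lt_two_pow_self) (Nat.pow_lt_pow_right (by norm_num) (Nat.lt_succ_self j))
  rcases le_total k (j + 1) with h | h
  · rw [coeff_shapiroP_of_le h hj]
  · rw [coeff_shapiroP_of_le h hj']

/-- `ε_j = ±1`. [cite: Rivlin1974, Sect. 3.3 (3.20)] -/
theorem shapiroSeq_eq_one_or_eq_neg_one (j : ℕ) : shapiroSeq j = 1 ∨ shapiroSeq j = -1 :=
  coeff_shapiroP_eq_one_or_eq_neg_one
    (lt_trans (Nat.lt_two_pow_self) (Nat.pow_lt_pow_right (by norm_num) (Nat.lt_succ_self j)))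

/-- `|ε_j| = 1`. [cite: Rivlin1974, Sect. 3.3 (3.20)] -/
theorem abs_shapiroSeq (j : ℕ) : |(shapiroSeq j : ℝ)| = 1 := by
  rcases shapiroSeq_eq_one_or_eq_neg_one j with h | h <;> simp [h]

/-- `‖ε_j‖ = 1` in `ℂ`. [cite: Rivlin1974, Sect. 3.3 (3.20)] -/
theorem norm_shapiroSeq (j : ℕ) : ‖(shapiroSeq j : ℂ)‖ = 1 := by
  rcases shapiroSeq_eq_one_or_eq_neg_one j with h | h <;> simp [h]

/-- `ε₀ = ε₁ = ε₂ = 1`, `ε₃ = -1` (`f₂ = 1 + z + z² - z³`). [cite: Rivlin1974, Sect. 3.3 (3.20)] -/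
theorem shapiroSeq_first : shapiroSeq 0 = 1 ∧ shapiroSeq 1 = 1 ∧ shapiroSeq 2 = 1 ∧ shapiroSeq 3 = -1 := by
  have h2 : ∀ j < 2 ^ 2, shapiroSeq j = (shapiroP 2).coeff j := fun j hj =>
    (coeff_shapiroP_eq_shapiroSeq hj).symm
  refine ⟨?_, ?_, ?_, ?_⟩ <;> rw [h2 _ (by norm_num), shapiroP_two] <;> simp [coeff_one, coeff_X]

/-- The partial sums `𝒮_n(z) = Σ_{j=0}^{n} ε_j z^j` of the series (3.20), as a function on `ℂ`.
[cite: Rivlin1974, Sect. 3.3 (3.20)] -/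
noncomputable def shapiroSum (n : ℕ) (z : ℂ) : ℂ := ∑ j ∈ range (n + 1), (shapiroSeq j : ℂ) * z ^ j

/-- The order-`n` partial sum of an integer polynomial, evaluated at `z`. [folklore] -/
private noncomputable def psum (p : ℤ[X]) (n : ℕ) (z : ℂ) : ℂ :=
  ∑ j ∈ range (n + 1), (p.coeff j : ℂ) * z ^ j

/-- A polynomial of degree `≤ n` is its own order-`n` partial sum. [folklore] -/
private theorem aeval_eq_psum {p : ℤ[X]} {n : ℕ} (hp : p.natDegree ≤ n) (z : ℂ) :
    aeval z p = psum p n z := by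
  rw [aeval_eq_sum_range' (Nat.lt_succ_of_le hp)]
  simp [psum, zsmul_eq_mul]

/-- For `n < 2^k` the order-`n` partial sum of `f_k` is `𝒮_n`. [folklore] -/
private theorem psum_shapiroP_eq_shapiroSum {k n : ℕ} (hn : n < 2 ^ k) (z : ℂ) :
    psum (shapiroP k) n z = shapiroSum n z := by
  refine sum_congr rfl fun j hj => ?_
  rw [coeff_shapiroP_eq_shapiroSeq (lt_of_le_of_lt (Nat.le_of_lt_succ (mem_range.1 hj)) hn)]

/-- `f_k = 𝒮_{2^k - 1}`. [cite: Rivlin1974, Sect. 3.3 (proof of Lemma 3.3.1)] -/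
theorem shapiroSum_two_pow_sub_one (k : ℕ) (z : ℂ) : shapiroSum (2 ^ k - 1) z = aeval z (shapiroP k) := by
  have hk : 0 < 2 ^ k := by positivity
  rw [aeval_eq_psum (natDegree_shapiroP k).le, psum_shapiroP_eq_shapiroSum (by omega)]

/-- `𝒮₀ = 1`. [cite: Rivlin1974, Sect. 3.3 (3.20)] -/
theorem shapiroSum_zero (z : ℂ) : shapiroSum 0 z = 1 := by
  simp [shapiroSum, shapiroSeq_first.1]

/-- `𝒮_{n+1}(z) = 𝒮_n(z) + ε_{n+1} z^{n+1}`. [cite: Rivlin1974, Sect. 3.3 (3.20)] -/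
theorem shapiroSum_succ (n : ℕ) (z : ℂ) :
    shapiroSum (n + 1) z = shapiroSum n z + (shapiroSeq (n + 1) : ℂ) * z ^ (n + 1) := by
  rw [shapiroSum, sum_range_succ, ← shapiroSum]

/-! ### On the unit circle: (3.22) and LEMMA 3.3.1 -/

/-- `|f_k(z)|² + |g_k(z)|² = 2^{k+1}` for `|z| = 1` (parallelogram identity and (3.19)).
[cite: Rivlin1974, Sect. 3.3 (proof of Lemma 3.3.1)] -/
theorem norm_sq_aeval_shapiroP_add (k : ℕ) {z : ℂ} (hz : ‖z‖ = 1) :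
    ‖aeval z (shapiroP k)‖ ^ 2 + ‖aeval z (shapiroQ k)‖ ^ 2 = 2 ^ (k + 1) := by
  induction k with
  | zero => simp [shapiroP_zero, shapiroQ_zero]; norm_num
  | succ k ih =>
    rw [shapiroP_succ, shapiroQ_succ, map_add, map_sub, map_mul, map_pow, aeval_X,
      parallelogram_law_with_norm ℂ, norm_mul, norm_pow, hz, one_pow, one_mul, ih]
    ring

/-- (3.22): `|f_k(z)| ≤ 2^{1/2} 2^{k/2}` on `|z| = 1`. [cite: Rivlin1974, Sect. 3.3 (3.22)] -/
theorem norm_aeval_shapiroP_le (k : ℕ) {z : ℂ} (hz : ‖z‖ = 1) :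
    ‖aeval z (shapiroP k)‖ ≤ Real.sqrt 2 ^ (k + 1) := by
  have h := norm_sq_aeval_shapiroP_add k hz
  have h2 : (Real.sqrt 2 ^ (k + 1)) ^ 2 = 2 ^ (k + 1) := by
    rw [← pow_mul, mul_comm, pow_mul, Real.sq_sqrt (by norm_num : (0:ℝ) ≤ 2)]
  have hP : ‖aeval z (shapiroP k)‖ ^ 2 ≤ (Real.sqrt 2 ^ (k + 1)) ^ 2 := by
    rw [h2]; nlinarith [sq_nonneg ‖aeval z (shapiroQ k)‖]
  have h' := sq_le_sq.1 hP
  rwa [abs_of_nonneg (norm_nonneg _),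
    abs_of_nonneg (by positivity : (0:ℝ) ≤ Real.sqrt 2 ^ (k + 1))] at h'

/-- `|g_k(z)| ≤ 2^{1/2} 2^{k/2}` on `|z| = 1`. [cite: Rivlin1974, Sect. 3.3 (3.22)] -/
theorem norm_aeval_shapiroQ_le (k : ℕ) {z : ℂ} (hz : ‖z‖ = 1) :
    ‖aeval z (shapiroQ k)‖ ≤ Real.sqrt 2 ^ (k + 1) := by
  have h := norm_sq_aeval_shapiroP_add k hz
  have h2 : (Real.sqrt 2 ^ (k + 1)) ^ 2 = 2 ^ (k + 1) := by
    rw [← pow_mul, mul_comm, pow_mul, Real.sq_sqrt (by norm_num : (0:ℝ) ≤ 2)]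
  have hQ : ‖aeval z (shapiroQ k)‖ ^ 2 ≤ (Real.sqrt 2 ^ (k + 1)) ^ 2 := by
    rw [h2]; nlinarith [sq_nonneg ‖aeval z (shapiroP k)‖]
  have h' := sq_le_sq.1 hQ
  rwa [abs_of_nonneg (norm_nonneg _),
    abs_of_nonneg (by positivity : (0:ℝ) ≤ Real.sqrt 2 ^ (k + 1))] at h'

/-- Splitting a partial sum of order `n ≥ 2^k` of `f_{k+1} = f_k + z^{2^k} g_k`:
`psum f_{k+1} n = f_k(z) + z^{2^k} · psum g_k (n - 2^k)`. [folklore] -/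
private theorem psum_shapiroP_succ_of_le {k n : ℕ} (hkn : 2 ^ k ≤ n) (z : ℂ) :
    psum (shapiroP (k + 1)) n z =
      aeval z (shapiroP k) + z ^ 2 ^ k * psum (shapiroQ k) (n - 2 ^ k) z := by
  have hk : 0 < 2 ^ k := by positivity
  unfold psum
  rw [← sum_range_add_sum_Ico _ (show 2 ^ k ≤ n + 1 by omega)]
  congr 1
  · rw [aeval_eq_psum (n := 2 ^ k - 1) (by rw [natDegree_shapiroP]), psum, Nat.sub_add_cancel hk]
    refine sum_congr rfl fun j hj => ?_
    rw [coeff_shapiroP_succ_of_lt (mem_range.1 hj)]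
  · rw [sum_Ico_eq_sum_range, show n + 1 - 2 ^ k = n - 2 ^ k + 1 by omega, mul_sum]
    refine sum_congr rfl fun j _ => ?_
    rw [coeff_shapiroP_succ_two_pow_add, pow_add]
    ring

/-- The companion splitting for `g_{k+1} = f_k - z^{2^k} g_k`. [folklore] -/
private theorem psum_shapiroQ_succ_of_le {k n : ℕ} (hkn : 2 ^ k ≤ n) (z : ℂ) :
    psum (shapiroQ (k + 1)) n z =
      aeval z (shapiroP k) - z ^ 2 ^ k * psum (shapiroQ k) (n - 2 ^ k) z := by
  have hk : 0 < 2 ^ k := by positivity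
  unfold psum
  rw [← sum_range_add_sum_Ico _ (show 2 ^ k ≤ n + 1 by omega), sub_eq_add_neg]
  congr 1
  · rw [aeval_eq_psum (n := 2 ^ k - 1) (by rw [natDegree_shapiroP]), psum, Nat.sub_add_cancel hk]
    refine sum_congr rfl fun j hj => ?_
    rw [coeff_shapiroQ_succ_of_lt (mem_range.1 hj)]
  · rw [sum_Ico_eq_sum_range, show n + 1 - 2 ^ k = n - 2 ^ k + 1 by omega, mul_sum, ← sum_neg_distrib]
    refine sum_congr rfl fun j _ => ?_
    rw [coeff_shapiroQ_succ_two_pow_add, pow_add]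
    push_cast
    ring

/-- Partial sums of order `n < 2^k` of `f_{k+1}` and of `g_{k+1}` are `𝒮_n`. [folklore] -/
private theorem psum_shapiroQ_succ_of_lt {k n : ℕ} (hn : n < 2 ^ k) (z : ℂ) :
    psum (shapiroQ (k + 1)) n z = shapiroSum n z := by
  refine sum_congr rfl fun j hj => ?_
  have hj' : j < 2 ^ k := lt_of_le_of_lt (Nat.le_of_lt_succ (mem_range.1 hj)) hn
  rw [coeff_shapiroQ_succ_of_lt hj', coeff_shapiroP_eq_shapiroSeq hj']

/-- (3.23a)–(3.23b): for `n ≤ 2^k - 1` and `|z| = 1`, both `|𝒮_n(z)|` and `|ℛ_n(z)|` (the order-`n` partial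
sum of `g_k`) are at most `(2 + 2^{1/2}) 2^{k/2}` — by induction on `k`. [folklore] -/
private theorem norm_psum_le_aux {z : ℂ} (hz : ‖z‖ = 1) (k : ℕ) :
    ∀ n, n < 2 ^ k →
      ‖shapiroSum n z‖ ≤ (2 + Real.sqrt 2) * Real.sqrt 2 ^ k ∧
        ‖psum (shapiroQ k) n z‖ ≤ (2 + Real.sqrt 2) * Real.sqrt 2 ^ k := by
  have hs2 : Real.sqrt 2 * Real.sqrt 2 = 2 := Real.mul_self_sqrt (by norm_num)
  have hs0 : 0 ≤ Real.sqrt 2 := Real.sqrt_nonneg 2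
  induction k with
  | zero =>
    intro n hn
    have h0 : n = 0 := by simpa using hn
    subst h0
    have h1 : (1 : ℝ) ≤ 2 + Real.sqrt 2 := by linarith
    constructor
    · simpa [shapiroSum_zero] using h1
    · simpa [psum, shapiroQ_zero] using h1
  | succ k ih =>
    intro n hn
    have h2k : 2 ^ (k + 1) = 2 * 2 ^ k := by ring
    have hmono : (2 + Real.sqrt 2) * Real.sqrt 2 ^ k ≤ (2 + Real.sqrt 2) * Real.sqrt 2 ^ (k + 1) := by
      rw [pow_succ]
      have : Real.sqrt 2 ^ k ≤ Real.sqrt 2 ^ k * Real.sqrt 2 := by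
        have h1 : (1 : ℝ) ≤ Real.sqrt 2 := by
          rw [show (1:ℝ) = Real.sqrt 1 by simp]; exact Real.sqrt_le_sqrt (by norm_num)
        nlinarith [pow_nonneg hs0 k]
      nlinarith
    by_cases hkn : 2 ^ k ≤ n
    · -- `2^k ≤ n ≤ 2^{k+1} - 1`: split off `f_k`
      have hm : n - 2 ^ k < 2 ^ k := by omega
      have ihm := (ih (n - 2 ^ k) hm).2
      have hf := norm_aeval_shapiroP_le k hz
      have hzn : ‖z ^ 2 ^ k‖ = 1 := by rw [norm_pow, hz, one_pow]
      have key : Real.sqrt 2 ^ (k + 1) + (2 + Real.sqrt 2) * Real.sqrt 2 ^ k =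
          (2 + Real.sqrt 2) * Real.sqrt 2 ^ (k + 1) := by
        rw [pow_succ]; linear_combination (-(Real.sqrt 2 ^ k)) * hs2
      constructor
      · rw [← psum_shapiroP_eq_shapiroSum hn, psum_shapiroP_succ_of_le hkn, ← key]
        refine (norm_add_le _ _).trans ?_
        rw [norm_mul, hzn, one_mul]
        exact add_le_add hf ihm
      · rw [psum_shapiroQ_succ_of_le hkn, ← key]
        refine (norm_sub_le _ _).trans ?_
        rw [norm_mul, hzn, one_mul]
        exact add_le_add hf ihm
    · rw [not_le] at hkn
      have ihn := ih n hkn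
      constructor
      · exact ihn.1.trans hmono
      · rw [psum_shapiroQ_succ_of_lt hkn]
        exact ihn.1.trans hmono

/-- (3.23a): `|𝒮_n(z)| ≤ (2 + 2^{1/2}) 2^{k/2}` whenever `n ≤ 2^k - 1` and `|z| = 1`.
[cite: Rivlin1974, Sect. 3.3 (3.23a)] -/
theorem norm_shapiroSum_le_of_lt_two_pow {k n : ℕ} (hn : n < 2 ^ k) {z : ℂ} (hz : ‖z‖ = 1) :
    ‖shapiroSum n z‖ ≤ (2 + Real.sqrt 2) * Real.sqrt 2 ^ k :=
  ((norm_psum_le_aux hz k) n hn).1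

/-- **LEMMA 3.3.1** (3.21): `|𝒮_n(z)| ≤ 5 n^{1/2}` for `n ≥ 1` and `|z| = 1`
(through `(2 + 2^{1/2}) 2^{k/2} ≤ 2^{1/2}(2 + 2^{1/2}) n^{1/2} ≤ 5 n^{1/2}` for `2^{k-1} ≤ n ≤ 2^k - 1`).
[cite: Rivlin1974, Sect. 3.3 Lemma 3.3.1 (3.21)] -/
theorem norm_shapiroSum_le {n : ℕ} (hn : 1 ≤ n) {z : ℂ} (hz : ‖z‖ = 1) :
    ‖shapiroSum n z‖ ≤ 5 * Real.sqrt n := by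
  -- `k - 1 = Nat.log 2 n`: `2^(k-1) ≤ n < 2^k`
  set m := Nat.log 2 n with hm
  have hlow : 2 ^ m ≤ n := Nat.pow_log_le_self 2 (by omega)
  have hup : n < 2 ^ (m + 1) := Nat.lt_pow_succ_log_self (by norm_num) n
  have h1 := norm_shapiroSum_le_of_lt_two_pow hup hz
  have hs0 : 0 ≤ Real.sqrt 2 := Real.sqrt_nonneg 2
  have hs2 : Real.sqrt 2 * Real.sqrt 2 = 2 := Real.mul_self_sqrt (by norm_num)
  have hsle : Real.sqrt 2 ≤ 3 / 2 := by
    rw [show (3/2 : ℝ) = Real.sqrt (9/4) by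
      rw [show (9/4 : ℝ) = (3/2)^2 by norm_num, Real.sqrt_sq (by norm_num)]]
    exact Real.sqrt_le_sqrt (by norm_num)
  -- `√2^m = √(2^m) ≤ √n`
  have hpow : Real.sqrt 2 ^ m ≤ Real.sqrt n := by
    refine (Real.le_sqrt (by positivity) (by positivity)).2 ?_
    rw [← pow_mul, mul_comm, pow_mul, Real.sq_sqrt (by norm_num : (0:ℝ) ≤ 2)]
    exact_mod_cast hlow
  have hc : (2 + Real.sqrt 2) * Real.sqrt 2 ≤ 5 := by nlinarith [hs2, hsle]
  have hc0 : 0 ≤ (2 + Real.sqrt 2) * Real.sqrt 2 := by positivity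
  calc ‖shapiroSum n z‖ ≤ (2 + Real.sqrt 2) * Real.sqrt 2 ^ (m + 1) := h1
    _ = ((2 + Real.sqrt 2) * Real.sqrt 2) * Real.sqrt 2 ^ m := by ring
    _ ≤ ((2 + Real.sqrt 2) * Real.sqrt 2) * Real.sqrt n := by gcongr
    _ ≤ 5 * Real.sqrt n := by gcongr

/-- LEMMA 3.3.1 as printed: `|𝒮_n(e^{iθ})| ≤ 5 n^{1/2}` for `n = 1, 2, …` and real `θ`.
[cite: Rivlin1974, Sect. 3.3 Lemma 3.3.1 (3.21)] -/
theorem norm_shapiroSum_exp_le {n : ℕ} (hn : 1 ≤ n) (θ : ℝ) :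
    ‖shapiroSum n (Complex.exp (θ * Complex.I))‖ ≤ 5 * Real.sqrt n :=
  norm_shapiroSum_le hn (Complex.norm_exp_ofReal_mul_I θ)

/-- A form of (3.21) valid for every `n ≥ 0`: `|𝒮_n(z)| ≤ 5 (n+1)^{1/2}` on `|z| = 1`.
[cite: Rivlin1974, Sect. 3.3 Lemma 3.3.1 (3.21)] -/
theorem norm_shapiroSum_le_sqrt_succ (n : ℕ) {z : ℂ} (hz : ‖z‖ = 1) :
    ‖shapiroSum n z‖ ≤ 5 * Real.sqrt (n + 1) := by
  rcases Nat.eq_zero_or_pos n with rfl | hn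
  · simp [shapiroSum_zero]
  · refine (norm_shapiroSum_le hn hz).trans ?_
    gcongr
    linarith

/-! ### THEOREM 3.1: `Σ ε_k T_k(x)/k` converges uniformly but not absolutely -/

/-- Summation by parts for `Σ_{k=n}^{N} ε_k z^k / k` (`ε_k z^k = 𝒮_k(z) - 𝒮_{k-1}(z)`).
[cite: Rivlin1974, Sect. 3.3 (proof of Thm. 3.1)] -/
theorem sum_Icc_shapiroSeq_div_eq {n N : ℕ} (hn : 1 ≤ n) (hnN : n ≤ N) (z : ℂ) :
    ∑ k ∈ Icc n N, (shapiroSeq k : ℂ) * z ^ k / k =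
      shapiroSum N z / N - shapiroSum (n - 1) z / n +
        ∑ k ∈ Ico n N, shapiroSum k z * (((1:ℝ) / k - 1 / (k + 1) : ℝ) : ℂ) := by
  induction N, hnN using Nat.le_induction with
  | base =>
    obtain ⟨m, rfl⟩ : ∃ m, n = m + 1 := ⟨n - 1, by omega⟩
    rw [Icc_self, sum_singleton, Ico_self, sum_empty, add_zero, Nat.add_sub_cancel, shapiroSum_succ]
    ring
  | succ N hnN ih =>
    have hN : (N : ℂ) ≠ 0 := by exact_mod_cast (show N ≠ 0 by omega)
    have hN1 : ((N : ℂ) + 1) ≠ 0 := by exact_mod_cast (show (N + 1 : ℕ) ≠ 0 by omega)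
    rw [sum_Icc_succ_top (by omega), ih, sum_Ico_succ_top hnN, shapiroSum_succ N]
    push_cast
    field_simp
    ring

/-- `n^{1/2} (1/n - 1/(n+1)) ≤ 2 (n^{-1/2} - (n+1)^{-1/2})` — the telescoping majorant replacing
`Σ_{k>n} k^{-3/2} ≤ ∫_n^∞ x^{-3/2} dx = 2 n^{-1/2}`. [folklore] -/
private theorem sqrt_mul_sub_le (k : ℕ) (hk : 1 ≤ k) :
    Real.sqrt k * ((1:ℝ) / k - 1 / (k + 1)) ≤ 2 * (1 / Real.sqrt k - 1 / Real.sqrt (k + 1)) := by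
  set a := Real.sqrt k with ha_def
  set b := Real.sqrt ((k:ℝ) + 1) with hb_def
  have hk' : (0:ℝ) < k := by exact_mod_cast hk
  have ha : 0 < a := Real.sqrt_pos.2 hk'
  have hb : 0 < b := Real.sqrt_pos.2 (by positivity)
  have ha2 : a ^ 2 = k := Real.sq_sqrt hk'.le
  have hb2 : b ^ 2 = k + 1 := Real.sq_sqrt (by positivity)
  have hk1 : (k:ℝ) = a ^ 2 := ha2.symm
  have hk2 : (k:ℝ) + 1 = b ^ 2 := hb2.symm
  rw [hk2, hk1]
  rw [div_sub_div _ _ (by positivity) (by positivity), div_sub_div _ _ ha.ne' hb.ne',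
    ← mul_div_assoc, ← mul_div_assoc, div_le_div_iff₀ (by positivity) (by positivity)]
  have H : 0 ≤ a * b * (b - a) ^ 2 := by positivity
  have h1 : b ^ 2 - a ^ 2 = 1 := by rw [ha2, hb2]; ring
  nlinarith [H, h1, mul_pos ha hb, mul_pos (mul_pos ha hb) hb, sq_nonneg (b - a), ha2, hb2,
    mul_pos (mul_pos ha hb) (mul_pos ha hb)]

/-- The telescoping sum `Σ_{k=n}^{N-1} (k^{-1/2} - (k+1)^{-1/2}) = n^{-1/2} - N^{-1/2}`. [folklore] -/
private theorem sum_Ico_inv_sqrt_sub {n N : ℕ} (hnN : n ≤ N) :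
    ∑ k ∈ Ico n N, ((1:ℝ) / Real.sqrt k - 1 / Real.sqrt (k + 1)) = 1 / Real.sqrt n - 1 / Real.sqrt N := by
  induction N, hnN using Nat.le_induction with
  | base => simp
  | succ N hnN ih =>
    rw [sum_Ico_succ_top hnN, ih]
    push_cast
    ring

/-- The block estimate of the printed proof: `|Σ_{k=n}^{N} ε_k z^k / k| ≤ 20 n^{-1/2}` for `n ≥ 1`,
`|z| = 1` (from (3.21) by summation by parts: `10 n^{-1/2} + 5 Σ_{k>n} k^{-3/2} ≤ 20 n^{-1/2}`).
[cite: Rivlin1974, Sect. 3.3 Thm. 3.1 (proof)] -/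
theorem norm_sum_Icc_shapiroSeq_div_le {n : ℕ} (hn : 1 ≤ n) (N : ℕ) {z : ℂ} (hz : ‖z‖ = 1) :
    ‖∑ k ∈ Icc n N, (shapiroSeq k : ℂ) * z ^ k / k‖ ≤ 20 / Real.sqrt n := by
  have hn0 : (0:ℝ) < n := by exact_mod_cast hn
  have hsn : 0 < Real.sqrt n := Real.sqrt_pos.2 hn0
  rcases Nat.lt_or_ge N n with hNn | hnN
  · rw [Icc_eq_empty (by omega), sum_empty, norm_zero]; positivity
  have hN0 : (0:ℝ) < N := by exact_mod_cast (lt_of_lt_of_le hn hnN)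
  rw [sum_Icc_shapiroSeq_div_eq hn hnN]
  -- the three pieces
  have T1 : ‖shapiroSum N z / N‖ ≤ 5 / Real.sqrt n := by
    rw [norm_div, Complex.norm_natCast, div_le_div_iff₀ hN0 hsn]
    calc ‖shapiroSum N z‖ * Real.sqrt n ≤ 5 * Real.sqrt N * Real.sqrt N := by
          have := norm_shapiroSum_le (lt_of_lt_of_le hn hnN) hz
          gcongr
      _ = 5 * N := by rw [mul_assoc, Real.mul_self_sqrt hN0.le]
  have T2 : ‖shapiroSum (n - 1) z / n‖ ≤ 5 / Real.sqrt n := by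
    rw [norm_div, Complex.norm_natCast, div_le_div_iff₀ hn0 hsn]
    calc ‖shapiroSum (n - 1) z‖ * Real.sqrt n ≤ 5 * Real.sqrt n * Real.sqrt n := by
          have := norm_shapiroSum_le_sqrt_succ (n - 1) hz
          rw [show ((n - 1 : ℕ) : ℝ) + 1 = n by
            rw [Nat.cast_sub hn]; push_cast; ring] at this
          gcongr
      _ = 5 * n := by rw [mul_assoc, Real.mul_self_sqrt hn0.le]
  have T3 : ‖∑ k ∈ Ico n N, shapiroSum k z * (((1:ℝ) / k - 1 / (k + 1) : ℝ) : ℂ)‖ ≤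
      10 / Real.sqrt n := by
    refine (norm_sum_le _ _).trans ?_
    calc ∑ k ∈ Ico n N, ‖shapiroSum k z * (((1:ℝ) / k - 1 / (k + 1) : ℝ) : ℂ)‖
        ≤ ∑ k ∈ Ico n N, 5 * (2 * (1 / Real.sqrt k - 1 / Real.sqrt (k + 1))) := by
          refine sum_le_sum fun k hk => ?_
          have hk1 : 1 ≤ k := le_trans hn (mem_Ico.1 hk).1
          have hk0 : (0:ℝ) < k := by exact_mod_cast hk1
          have hnn : (0:ℝ) ≤ 1 / k - 1 / (k + 1) := by
            rw [sub_nonneg]; exact one_div_le_one_div_of_le hk0 (by linarith)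
          rw [norm_mul, Complex.norm_real, Real.norm_eq_abs, abs_of_nonneg hnn]
          calc ‖shapiroSum k z‖ * (1 / k - 1 / (k + 1))
              ≤ 5 * Real.sqrt k * (1 / k - 1 / (k + 1)) := by
                gcongr; exact norm_shapiroSum_le hk1 hz
            _ = 5 * (Real.sqrt k * (1 / k - 1 / (k + 1))) := by ring
            _ ≤ 5 * (2 * (1 / Real.sqrt k - 1 / Real.sqrt (k + 1))) :=
                mul_le_mul_of_nonneg_left (sqrt_mul_sub_le k hk1) (by norm_num)
      _ = 10 * (1 / Real.sqrt n - 1 / Real.sqrt N) := by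
          rw [← mul_sum, ← mul_sum, sum_Ico_inv_sqrt_sub hnN]; ring
      _ ≤ 10 / Real.sqrt n := by
          have : 0 ≤ 1 / Real.sqrt N := by positivity
          rw [div_eq_mul_one_div 10]
          nlinarith
  calc ‖shapiroSum N z / N - shapiroSum (n - 1) z / n +
          ∑ k ∈ Ico n N, shapiroSum k z * (((1:ℝ) / k - 1 / (k + 1) : ℝ) : ℂ)‖
      ≤ ‖shapiroSum N z / N‖ + ‖shapiroSum (n - 1) z / n‖ +
          ‖∑ k ∈ Ico n N, shapiroSum k z * (((1:ℝ) / k - 1 / (k + 1) : ℝ) : ℂ)‖ :=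
        (norm_add_le _ _).trans (add_le_add (norm_sub_le _ _) le_rfl)
    _ ≤ 5 / Real.sqrt n + 5 / Real.sqrt n + 10 / Real.sqrt n := add_le_add (add_le_add T1 T2) T3
    _ = 20 / Real.sqrt n := by ring

/-- Real form: `|Σ_{k=n}^{N} ε_k cos(kθ)/k| ≤ 20 n^{-1/2}` ("since `|Re z| ≤ |z|`").
[cite: Rivlin1974, Sect. 3.3 Thm. 3.1 (proof)] -/
theorem abs_sum_Icc_shapiroSeq_mul_cos_div_le {n : ℕ} (hn : 1 ≤ n) (N : ℕ) (θ : ℝ) :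
    |∑ k ∈ Icc n N, (shapiroSeq k : ℝ) * Real.cos (k * θ) / k| ≤ 20 / Real.sqrt n := by
  have h := norm_sum_Icc_shapiroSeq_div_le hn N (Complex.norm_exp_ofReal_mul_I θ)
  have hre : (∑ k ∈ Icc n N, (shapiroSeq k : ℂ) * Complex.exp (θ * Complex.I) ^ k / k).re =
      ∑ k ∈ Icc n N, (shapiroSeq k : ℝ) * Real.cos (k * θ) / k := by
    rw [Complex.re_sum]
    refine sum_congr rfl fun k _ => ?_
    rw [← Complex.exp_nat_mul, show (k : ℂ) * (θ * Complex.I) = ((k * θ : ℝ) : ℂ) * Complex.I by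
      push_cast; ring, Complex.div_natCast_re, Complex.mul_re, Complex.exp_ofReal_mul_I_re,
      Complex.exp_ofReal_mul_I_im]
    simp
  rw [← hre]
  exact (Complex.abs_re_le_norm _).trans h

/-- The partial sums `Σ_{k=1}^{N} (ε_k/k) T_k(x)` of the Chebyshev series (3.24).
[cite: Rivlin1974, Sect. 3.3 Thm. 3.1 (3.24)] -/
noncomputable def chebyshevShapiroSum (N : ℕ) (x : ℝ) : ℝ :=
  ∑ k ∈ Icc 1 N, (shapiroSeq k : ℝ) * (Chebyshev.T ℝ k).eval x / k

/-- The partial sums are polynomials, hence continuous. [cite: Rivlin1974, Sect. 3.3 Thm. 3.1 (3.24)] -/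
theorem continuous_chebyshevShapiroSum (N : ℕ) : Continuous (chebyshevShapiroSum N) := by
  unfold chebyshevShapiroSum
  exact continuous_finsetSum _ fun k _ =>
    (continuous_const.mul (Polynomial.continuous _)).div_const _

/-- On `I`, with `x = cos θ`: `|Σ_{k=n}^{N} ε_k T_k(x)/k| ≤ 20 n^{-1/2}` for `n ≥ 1`.
[cite: Rivlin1974, Sect. 3.3 Thm. 3.1 (proof)] -/
theorem abs_sum_Icc_shapiroSeq_mul_T_div_le {n : ℕ} (hn : 1 ≤ n) (N : ℕ) {x : ℝ}
    (hx : x ∈ Set.Icc (-1 : ℝ) 1) :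
    |∑ k ∈ Icc n N, (shapiroSeq k : ℝ) * (Chebyshev.T ℝ k).eval x / k| ≤ 20 / Real.sqrt n := by
  have hcos : Real.cos (Real.arccos x) = x := Real.cos_arccos hx.1 hx.2
  have h := abs_sum_Icc_shapiroSeq_mul_cos_div_le hn N (Real.arccos x)
  have heq : ∑ k ∈ Icc n N, (shapiroSeq k : ℝ) * (Chebyshev.T ℝ k).eval x / k =
      ∑ k ∈ Icc n N, (shapiroSeq k : ℝ) * Real.cos (k * Real.arccos x) / k := by
    refine sum_congr rfl fun k _ => ?_
    rw [← hcos, Chebyshev.T_real_cos, hcos]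
    push_cast
    ring_nf
  rw [heq]
  exact h

/-- `S_N(x) - S_n(x) = Σ_{k=n+1}^{N} ε_k T_k(x)/k` for `n ≤ N`. [cite: Rivlin1974, Sect. 3.3 Thm. 3.1 (3.24)] -/
theorem chebyshevShapiroSum_sub {n N : ℕ} (hnN : n ≤ N) (x : ℝ) :
    chebyshevShapiroSum N x - chebyshevShapiroSum n x =
      ∑ k ∈ Icc (n + 1) N, (shapiroSeq k : ℝ) * (Chebyshev.T ℝ k).eval x / k := by
  induction N, hnN using Nat.le_induction with
  | base => rw [sub_self, Icc_eq_empty (by omega), sum_empty]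
  | succ N hnN ih =>
    rw [chebyshevShapiroSum, sum_Icc_succ_top (by omega), ← chebyshevShapiroSum, add_sub_right_comm, ih,
      sum_Icc_succ_top (by omega)]

/-- The uniform Cauchy estimate on `I`: `|S_N(x) - S_n(x)| ≤ 20 (n+1)^{-1/2}` for `n ≤ N`, `x ∈ I`.
[cite: Rivlin1974, Sect. 3.3 Thm. 3.1 (proof)] -/
theorem abs_chebyshevShapiroSum_sub_le {n N : ℕ} (hnN : n ≤ N) {x : ℝ} (hx : x ∈ Set.Icc (-1 : ℝ) 1) :
    |chebyshevShapiroSum N x - chebyshevShapiroSum n x| ≤ 20 / Real.sqrt (n + 1) := by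
  rw [chebyshevShapiroSum_sub hnN]
  have h := abs_sum_Icc_shapiroSeq_mul_T_div_le (n := n + 1) (by omega) N hx
  push_cast at h
  exact h

/-- THEOREM 3.1, first half: the partial sums of (3.24) are uniformly Cauchy on `I = [-1, 1]`.
[cite: Rivlin1974, Sect. 3.3 Thm. 3.1] -/
theorem uniformCauchySeqOn_chebyshevShapiroSum :
    UniformCauchySeqOn chebyshevShapiroSum atTop (Set.Icc (-1 : ℝ) 1) := by
  refine Metric.uniformCauchySeqOn_iff.2 fun ε hε => ?_
  obtain ⟨M, hM⟩ := exists_nat_gt ((20 / ε) ^ 2)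
  have hM' : 20 / Real.sqrt (M + 1) < ε := by
    have hs : 0 < Real.sqrt (M + 1) := Real.sqrt_pos.2 (by positivity)
    have h1 : 20 / ε < Real.sqrt (M + 1) := by
      refine (Real.lt_sqrt (by positivity)).2 ?_
      linarith
    rw [div_lt_iff₀ hs]
    have := (div_lt_iff₀' hε).1 h1
    linarith
  have key : ∀ m ≥ M, ∀ n ≥ M, n ≤ m → ∀ x ∈ Set.Icc (-1 : ℝ) 1,
      dist (chebyshevShapiroSum m x) (chebyshevShapiroSum n x) < ε := by
    intro m hm n hn hnm x hx
    rw [Real.dist_eq]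
    refine (abs_chebyshevShapiroSum_sub_le hnm hx).trans_lt (lt_of_le_of_lt ?_ hM')
    gcongr
  refine ⟨M, fun m hm n hn x hx => ?_⟩
  rcases le_total n m with h | h
  · exact key m hm n hn h x hx
  · rw [dist_comm]; exact key n hn m hm h x hx

/-- **THEOREM 3.1** (uniform convergence): the Chebyshev series `Σ_{k ≥ 1} (ε_k/k) T_k(x)` (3.24)
converges uniformly on `I = [-1, 1]` (to a continuous sum `g`). [cite: Rivlin1974, Sect. 3.3 Thm. 3.1] -/
theorem exists_tendstoUniformlyOn_chebyshevShapiroSum :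
    ∃ g : ℝ → ℝ, ContinuousOn g (Set.Icc (-1 : ℝ) 1) ∧
      TendstoUniformlyOn chebyshevShapiroSum g atTop (Set.Icc (-1 : ℝ) 1) := by
  have hU := uniformCauchySeqOn_chebyshevShapiroSum
  have hpt : ∀ x ∈ Set.Icc (-1 : ℝ) 1,
      Tendsto (fun N => chebyshevShapiroSum N x) atTop
        (nhds (limUnder atTop fun N => chebyshevShapiroSum N x)) :=
    fun x hx => tendsto_nhds_limUnder (cauchySeq_tendsto_of_complete (hU.cauchySeq hx))
  have hT := hU.tendstoUniformlyOn_of_tendsto hpt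
  exact ⟨_, hT.continuousOn (Eventually.frequently (Eventually.of_forall fun N =>
    (continuous_chebyshevShapiroSum N).continuousOn)), hT⟩

/-- **THEOREM 3.1** (failure of absolute convergence): (3.18) fails for (3.24) — `Σ' |B_k| = Σ 1/k`
diverges ("obvious, since `|ε_j| = 1` for all `j`"). [cite: Rivlin1974, Sect. 3.3 Thm. 3.1] -/
theorem not_summable_abs_shapiroSeq_div : ¬ Summable (fun k : ℕ => |(shapiroSeq k : ℝ) / k|) := by
  have h : (fun k : ℕ => |(shapiroSeq k : ℝ) / k|) = fun k : ℕ => 1 / (k : ℝ) := by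
    funext k
    rw [abs_div, abs_shapiroSeq, Nat.abs_cast]
  rw [h]
  exact Real.not_summable_one_div_natCast

/-- … and already at the point `x = 1 ∈ I` (where `T_k(1) = 1`) the series (3.24) is not absolutely
convergent. [cite: Rivlin1974, Sect. 3.3 Thm. 3.1] -/
theorem not_summable_abs_shapiroSeq_mul_T_one_div :
    ¬ Summable (fun k : ℕ => |(shapiroSeq k : ℝ) * (Chebyshev.T ℝ k).eval 1 / k|) := by
  simpa [Chebyshev.T_eval_one] using not_summable_abs_shapiroSeq_div

/-! ### `A(I) ⊆ U(I)`: absolutely convergent Chebyshev series converge uniformly -/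

/-- If `Σ |B_k| < ∞` (3.18), the Chebyshev series `Σ B_k T_k(x)` converges absolutely and uniformly on
`I` (Weierstrass M-test with `|T_k(x)| ≤ 1`): `A(I) ⊆ U(I)`. [cite: Rivlin1974, Sect. 3.3 (3.17)-(3.18)] -/
theorem tendstoUniformlyOn_chebyshevSeries_of_summable {B : ℕ → ℝ} (hB : Summable fun k => |B k|) :
    TendstoUniformlyOn (fun N x => ∑ k ∈ range N, B k * (Chebyshev.T ℝ k).eval x)
      (fun x => ∑' k, B k * (Chebyshev.T ℝ k).eval x) atTop (Set.Icc (-1 : ℝ) 1) := by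
  refine tendstoUniformlyOn_tsum_nat hB fun k x hx => ?_
  rw [Real.norm_eq_abs, abs_mul]
  exact mul_le_of_le_one_right (abs_nonneg _)
    (Chebyshev.abs_eval_T_real_le_one k (abs_le.2 ⟨hx.1, hx.2⟩))

end Literature.Analysis.Approximation.ShapiroPolynomials
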